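import Literature.NumberTheory.GaloisRepresentations.NearlyOrdinaryPresentationLifts
import Literature.NumberTheory.GaloisRepresentations.AdjointCoefficients
import HarnessLib

/-!
# The mother extension `𝒪⟦T⟧/(𝔪J + 𝔪ⁿ)` and its coefficient functionals

Topic `Literature/NumberTheory/GaloisRepresentations`.  Ring-theoretic part of the LINEARITY of
Mazur's obstruction map ([Maz89, §1.6 Prop. 2]; [Böc07, (1) and Thm. 2.4]).  For a surjection
`Θ : 𝒪⟦T₁, …, T_m⟧ ↠ R` of local `𝒪`-algebras with kernel `J` and an exponent `n ≥ 1` with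
`J ∩ 𝔪ⁿ ⊆ 𝔪J` (Artin–Rees):

* `motherIdeal Θ n = 𝔪J + 𝔪ⁿ` and the "mother" small extension
  `q₀ : B₀ = 𝒪⟦T⟧/(𝔪J + 𝔪ⁿ) ↠ R/𝔪ⁿ` (`q0Raw`: onto, square-zero kernel `I₀ = (J + 𝔪ⁿ)/(𝔪J + 𝔪ⁿ)`,
  killed by `𝔪`), mapping to every pushed-out extension `B_u = 𝒪⟦T⟧/(J_u + 𝔪ⁿ)`
  (`toPushout`, `quRaw_comp_toPushout`);
* `jPart`, `coeffFun u` — the **coefficient functional** `Λ_u : B₀ → κ` (`κ = 𝒪⟦T⟧/𝔪` the residue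
  field) attached to `u ∈ (J/𝔪J)^*`: on `I₀` it is `[j + m] ↦ u [j]` (well defined BECAUSE
  `J ∩ 𝔪ⁿ ⊆ 𝔪J`), extended by `0`; it is kernel-additive and `res`-semilinear
  (`isKernelSemilinear_coeffFun`, the input of `LiftingObstruction.kernelEntrywise`) and ADDITIVE
  IN `u` (`coeffFun_add`);
* `coeffFunPush u` — the same functional on `B_u`, compatible with `toPushout`
  (`coeffFunPush_toPushout`), vanishing criterion `coeffFunPush_mk_eq_zero_iff` (it is injective
  on `ker q_u`) and onto `κ` for `u ≠ 0` (`coeffFunPush_surjective`) — so on `B_u` the entrywise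
  coefficient map identifies `M₂(I_u)` with `M₂(κ)`.

Everything is proved; no named facts.

## References

* B. Mazur, *Deforming Galois representations*, MSRI Publ. 16 (1989), §1.6 Prop. 2.
  [cite: Mazur1989Deforming, §1.6 Prop. 2]
* G. Böckle, *Presentations of universal deformation rings*, LMS LNS 320 (2007), Thm. 2.4 and
  (1). [cite: Bockle2007Presentations, Theorem 2.2]
-/

noncomputable section

open IsLocalRing

namespace Literature.NumberTheory.GaloisRepresentations

/-! ## 0. Transport of sections and defects along a ring homomorphism -/

namespace LiftingObstruction

variable {ι : Type*} [Fintype ι] [DecidableEq ι] {A B₀ B₁ : Type*} [CommRing A] [CommRing B₀]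
  [CommRing B₁] {G : Type*} [Group G]

/-- Transporting a set-theoretic lift along `f : B₀ → B₁`: `GL_n(f) ∘ s`. [folklore] -/
def mapSection (f : B₀ →+* B₁) (s : GL ι A → GL ι B₀) (g : GL ι A) : GL ι B₁ :=
  Matrix.GeneralLinearGroup.map f (s g)

/-- `GL_n(f) ∘ s` is a section of `GL_n(φ₁)` if `s` is a section of `GL_n(φ₀)` and
`φ₁ ∘ f = φ₀`. [folklore] -/
theorem map_mapSection {φ₀ : B₀ →+* A} {φ₁ : B₁ →+* A} (f : B₀ →+* B₁)
    (hf : φ₁.comp f = φ₀) {s : GL ι A → GL ι B₀}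
    (hs : ∀ g, Matrix.GeneralLinearGroup.map φ₀ (s g) = g) (g : GL ι A) :
    Matrix.GeneralLinearGroup.map φ₁ (mapSection f s g) = g := by
  rw [mapSection, ← Matrix.GeneralLinearGroup.map_comp_apply, ← Matrix.GeneralLinearGroup.map_comp,
    hf, hs]

/-- **The defect of the transported section is the transported defect**:
`c_{f ∘ s}(σ, τ) = f(c_s(σ, τ))` entrywise. [folklore] -/
theorem liftDefect_mapSection (f : B₀ →+* B₁) (s : GL ι A → GL ι B₀) (ρ : G →* GL ι A)
    (σ τ : G) :
    liftDefect (mapSection f s) ρ σ τ = f.mapMatrix (liftDefect s ρ σ τ) := by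
  have h : defectUnit (mapSection f s) ρ σ τ =
      Matrix.GeneralLinearGroup.map f (defectUnit s ρ σ τ) := by
    simp only [defectUnit, mapSection, map_mul, map_inv]
  rw [liftDefect, liftDefect, h, map_sub, map_one]
  rfl

/-- Transported sections preserve parabolic values. [folklore] -/
theorem mapSection_mem_parabolicGL {α : Type*} [LinearOrder α] (b : ι → α) (f : B₀ →+* B₁)
    {s : GL ι A → GL ι B₀} (hsP : ∀ g ∈ parabolicGL b A, s g ∈ parabolicGL b B₀)
    (g : GL ι A) (hg : g ∈ parabolicGL b A) : mapSection f s g ∈ parabolicGL b B₁ :=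
  map_mem_parabolicGL f (hsP g hg)

end LiftingObstruction

namespace NearlyOrdinaryPresentationCA

section Mother

variable {𝒪 : Type} [CommRing 𝒪] [IsLocalRing 𝒪] {R : Type} [CommRing R] [IsLocalRing R]
  [Algebra 𝒪 R] {m : ℕ} (Θ : MvPowerSeries (Fin m) 𝒪 →ₐ[𝒪] R) (hΘ : Function.Surjective Θ)
  (n : ℕ)

/-! ## 1. The mother ideal `𝔪J + 𝔪ⁿ` -/

/-- The ideal `𝔪J + 𝔪ⁿ` of `𝒪⟦T⟧` (`J = ker Θ`). [cite: Mazur1989Deforming, §1.6 Prop. 2] -/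
def motherIdeal : Ideal (MvPowerSeries (Fin m) 𝒪) :=
  maximalIdeal (MvPowerSeries (Fin m) 𝒪) * RingHom.ker Θ ⊔ maximalIdeal (MvPowerSeries (Fin m) 𝒪) ^ n

omit [IsLocalRing R] in
/-- `𝔪J + 𝔪ⁿ ⊆ J + 𝔪ⁿ`. [folklore] -/
theorem motherIdeal_le_sup :
    motherIdeal Θ n ≤ RingHom.ker Θ ⊔ maximalIdeal (MvPowerSeries (Fin m) 𝒪) ^ n :=
  sup_le_sup_right Ideal.mul_le_left _

omit [IsLocalRing R] in
/-- `𝔪J + 𝔪ⁿ ⊆ J_u + 𝔪ⁿ` for every functional `u` on `J/𝔪J`. [cite: Mazur1989Deforming, §1.6 Prop. 2] -/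
theorem motherIdeal_le_pushoutTruncIdeal
    (u : Module.Dual (MvPowerSeries (Fin m) 𝒪 ⧸ maximalIdeal (MvPowerSeries (Fin m) 𝒪))
      (↥(RingHom.ker Θ) ⧸ (maximalIdeal (MvPowerSeries (Fin m) 𝒪) •
        (⊤ : Submodule (MvPowerSeries (Fin m) 𝒪) ↥(RingHom.ker Θ))))) :
    motherIdeal Θ n ≤ pushoutTruncIdeal Θ u n :=
  sup_le_sup_right (Literature.RingTheory.CompleteLocalRings.maximalIdeal_mul_le_pushoutIdeal _ u) _

omit [IsLocalRing R] in
/-- `𝔪J + 𝔪ⁿ ⊆ 𝔪` for `n ≠ 0`. [folklore] -/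
theorem motherIdeal_le_maximalIdeal (hn0 : n ≠ 0) :
    motherIdeal Θ n ≤ maximalIdeal (MvPowerSeries (Fin m) 𝒪) :=
  sup_le Ideal.mul_le_right (Ideal.pow_le_self hn0)

omit [IsLocalRing R] in
/-- `𝔪J + 𝔪ⁿ ≠ ⊤` for `n ≠ 0`. [folklore] -/
theorem motherIdeal_ne_top (hn0 : n ≠ 0) : motherIdeal Θ n ≠ ⊤ := fun h =>
  (maximalIdeal.isMaximal (MvPowerSeries (Fin m) 𝒪)).ne_top
    (top_le_iff.mp (h ▸ motherIdeal_le_maximalIdeal Θ n hn0))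

omit [IsLocalRing R] in
/-- `𝔪 · (J + 𝔪ⁿ) ⊆ 𝔪J + 𝔪ⁿ`: the kernel of the mother extension is killed by `𝔪`.
[cite: Mazur1989Deforming, §1.6 Prop. 2] -/
theorem maximalIdeal_mul_sup_le_motherIdeal :
    maximalIdeal (MvPowerSeries (Fin m) 𝒪) *
        (RingHom.ker Θ ⊔ maximalIdeal (MvPowerSeries (Fin m) 𝒪) ^ n) ≤ motherIdeal Θ n := by
  rw [Ideal.mul_sup]
  exact sup_le_sup_left Ideal.mul_le_left _

/-- `(J + 𝔪ⁿ)² ⊆ 𝔪J + 𝔪ⁿ` (`n ≠ 0`). [cite: Mazur1989Deforming, §1.6 Prop. 2] -/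
theorem sup_mul_sup_le_motherIdeal (hn0 : n ≠ 0) :
    (RingHom.ker Θ ⊔ maximalIdeal (MvPowerSeries (Fin m) 𝒪) ^ n) *
        (RingHom.ker Θ ⊔ maximalIdeal (MvPowerSeries (Fin m) 𝒪) ^ n) ≤ motherIdeal Θ n := by
  refine le_trans (Ideal.mul_mono_left ?_) (maximalIdeal_mul_sup_le_motherIdeal Θ n)
  exact sup_le (IsLocalRing.le_maximalIdeal (RingHom.ker_ne_top _)) (Ideal.pow_le_self hn0)

/-! ## 2. The mother extension `q₀ : 𝒪⟦T⟧/(𝔪J + 𝔪ⁿ) ↠ R/𝔪ⁿ` -/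

/-- **The mother small extension** `q₀ : 𝒪⟦T⟧/(𝔪J + 𝔪ⁿ) ↠ R/𝔪ⁿ`.
[cite: Mazur1989Deforming, §1.6 Prop. 2] -/
def q0Raw : (MvPowerSeries (Fin m) 𝒪 ⧸ motherIdeal Θ n) →ₐ[𝒪] R ⧸ maximalIdeal R ^ n :=
  ((truncEquiv Θ hΘ n : (MvPowerSeries (Fin m) 𝒪 ⧸ (RingHom.ker Θ ⊔
      maximalIdeal (MvPowerSeries (Fin m) 𝒪) ^ n)) →ₐ[𝒪] R ⧸ maximalIdeal R ^ n)).comp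
    (Ideal.Quotient.factorₐ 𝒪 (I := motherIdeal Θ n)
      (J := RingHom.ker Θ ⊔ maximalIdeal (MvPowerSeries (Fin m) 𝒪) ^ n) (motherIdeal_le_sup Θ n))

/-- `q₀` on residue classes. [folklore] -/
@[simp] theorem q0Raw_mk (x : MvPowerSeries (Fin m) 𝒪) :
    q0Raw Θ hΘ n (Ideal.Quotient.mk (motherIdeal Θ n) x) =
      Ideal.Quotient.mk (maximalIdeal R ^ n) (Θ x) := by
  change truncEquiv Θ hΘ n (Ideal.Quotient.factorₐ 𝒪 (I := motherIdeal Θ n)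
      (J := RingHom.ker Θ ⊔ maximalIdeal (MvPowerSeries (Fin m) 𝒪) ^ n)
      (motherIdeal_le_sup Θ n) (Ideal.Quotient.mk _ x)) = _
  rw [Ideal.Quotient.factorₐ_apply, Ideal.Quotient.factor_mk, truncEquiv_mk]

/-- `q₀` is onto. [folklore] -/
theorem q0Raw_surjective : Function.Surjective (q0Raw Θ hΘ n) := by
  intro y
  obtain ⟨r, rfl⟩ := Ideal.Quotient.mk_surjective y
  obtain ⟨x, rfl⟩ := hΘ r
  exact ⟨Ideal.Quotient.mk _ x, q0Raw_mk Θ hΘ n x⟩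

/-- `q₀ (mk x) = 0 ↔ x ∈ J + 𝔪ⁿ`. [folklore] -/
theorem q0Raw_mk_eq_zero_iff (x : MvPowerSeries (Fin m) 𝒪) :
    q0Raw Θ hΘ n (Ideal.Quotient.mk (motherIdeal Θ n) x) = 0 ↔
      x ∈ RingHom.ker Θ ⊔ maximalIdeal (MvPowerSeries (Fin m) 𝒪) ^ n := by
  rw [q0Raw_mk, ← ker_truncMap Θ hΘ n, RingHom.mem_ker, truncMap_apply]

/-- **`ker q₀` has square zero** (`n ≠ 0`). [cite: Mazur1989Deforming, §1.6 Prop. 2] -/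
theorem q0Raw_sqZero (hn0 : n ≠ 0) (x y : MvPowerSeries (Fin m) 𝒪 ⧸ motherIdeal Θ n)
    (hx : q0Raw Θ hΘ n x = 0) (hy : q0Raw Θ hΘ n y = 0) : x * y = 0 := by
  obtain ⟨a, rfl⟩ := Ideal.Quotient.mk_surjective x
  obtain ⟨b, rfl⟩ := Ideal.Quotient.mk_surjective y
  rw [q0Raw_mk_eq_zero_iff] at hx hy
  rw [← map_mul, Ideal.Quotient.eq_zero_iff_mem]
  exact sup_mul_sup_le_motherIdeal Θ n hn0 (Ideal.mul_mem_mul hx hy)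

omit [IsLocalRing R] in
/-- **`ker q₀` is killed by `𝔪_{B₀}`**: `a x = 0` for `a` in the maximal ideal and `x ∈ ker q₀`
(so `I₀` is a `κ`-vector space). [cite: Mazur1989Deforming, §1.6 Prop. 2] -/
theorem mk_mul_eq_zero_of_mem {a x : MvPowerSeries (Fin m) 𝒪}
    (ha : a ∈ maximalIdeal (MvPowerSeries (Fin m) 𝒪))
    (hx : x ∈ RingHom.ker Θ ⊔ maximalIdeal (MvPowerSeries (Fin m) 𝒪) ^ n) :
    Ideal.Quotient.mk (motherIdeal Θ n) (a * x) = 0 :=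
  Ideal.Quotient.eq_zero_iff_mem.mpr (maximalIdeal_mul_sup_le_motherIdeal Θ n (Ideal.mul_mem_mul ha hx))

variable (u : Module.Dual (MvPowerSeries (Fin m) 𝒪 ⧸ maximalIdeal (MvPowerSeries (Fin m) 𝒪))
    (↥(RingHom.ker Θ) ⧸ (maximalIdeal (MvPowerSeries (Fin m) 𝒪) •
      (⊤ : Submodule (MvPowerSeries (Fin m) 𝒪) ↥(RingHom.ker Θ)))))

/-- The comparison map `B₀ = 𝒪⟦T⟧/(𝔪J + 𝔪ⁿ) → B_u = 𝒪⟦T⟧/(J_u + 𝔪ⁿ)`.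
[cite: Mazur1989Deforming, §1.6 Prop. 2] -/
def toPushout : (MvPowerSeries (Fin m) 𝒪 ⧸ motherIdeal Θ n) →ₐ[𝒪]
    (MvPowerSeries (Fin m) 𝒪 ⧸ pushoutTruncIdeal Θ u n) :=
  Ideal.Quotient.factorₐ 𝒪 (I := motherIdeal Θ n) (J := pushoutTruncIdeal Θ u n)
    (motherIdeal_le_pushoutTruncIdeal Θ n u)

omit [IsLocalRing R] in
/-- `toPushout` on residue classes. [folklore] -/
@[simp] theorem toPushout_mk (x : MvPowerSeries (Fin m) 𝒪) :
    toPushout Θ n u (Ideal.Quotient.mk (motherIdeal Θ n) x) =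
      Ideal.Quotient.mk (pushoutTruncIdeal Θ u n) x :=
  rfl

/-- **`q_u ∘ (B₀ → B_u) = q₀`**: the pushed-out extensions receive the mother extension.
[cite: Mazur1989Deforming, §1.6 Prop. 2] -/
theorem quRaw_comp_toPushout :
    (quRaw Θ hΘ u n).comp (toPushout Θ n u) = q0Raw Θ hΘ n := by
  refine Ideal.Quotient.algHom_ext 𝒪 (AlgHom.ext fun x => ?_)
  change quRaw Θ hΘ u n (toPushout Θ n u (Ideal.Quotient.mk _ x)) = q0Raw Θ hΘ n (Ideal.Quotient.mk _ x)
  rw [toPushout_mk, quRaw_mk, q0Raw_mk]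

/-! ## 3. The `J`-component of an element of `J + 𝔪ⁿ` -/

variable (hJn : RingHom.ker Θ ⊓ maximalIdeal (MvPowerSeries (Fin m) 𝒪) ^ n ≤
    maximalIdeal (MvPowerSeries (Fin m) 𝒪) * RingHom.ker Θ)

omit [IsLocalRing R] in
/-- A chosen `J`-component of `y ∈ J + 𝔪ⁿ`. [folklore] -/
def jPart (y : MvPowerSeries (Fin m) 𝒪)
    (hy : y ∈ RingHom.ker Θ ⊔ maximalIdeal (MvPowerSeries (Fin m) 𝒪) ^ n) : ↥(RingHom.ker Θ) :=
  ⟨Classical.choose (Submodule.mem_sup.mp hy), (Classical.choose_spec (Submodule.mem_sup.mp hy)).1⟩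

omit [IsLocalRing R] in
/-- `y = jPart y + m` with `m ∈ 𝔪ⁿ`. [folklore] -/
theorem jPart_spec (y : MvPowerSeries (Fin m) 𝒪)
    (hy : y ∈ RingHom.ker Θ ⊔ maximalIdeal (MvPowerSeries (Fin m) 𝒪) ^ n) :
    ∃ z ∈ maximalIdeal (MvPowerSeries (Fin m) 𝒪) ^ n, y = (jPart Θ n y hy : MvPowerSeries (Fin m) 𝒪) + z := by
  obtain ⟨z, hz, hyz⟩ := (Classical.choose_spec (Submodule.mem_sup.mp hy)).2
  exact ⟨z, hz, hyz.symm⟩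

omit [IsLocalRing R] in
/-- An element of `J` lying in `𝔪J` (as an element of the ring) is zero in `J/𝔪J`. [folklore] -/
theorem mkQ_eq_zero_of_mem_mul {j : ↥(RingHom.ker Θ)}
    (hj : (j : MvPowerSeries (Fin m) 𝒪) ∈ maximalIdeal (MvPowerSeries (Fin m) 𝒪) * RingHom.ker Θ) :
    (Submodule.Quotient.mk j : ↥(RingHom.ker Θ) ⧸ (maximalIdeal (MvPowerSeries (Fin m) 𝒪) •
      (⊤ : Submodule (MvPowerSeries (Fin m) 𝒪) ↥(RingHom.ker Θ)))) = 0 := by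
  rw [Submodule.Quotient.mk_eq_zero]
  have hmap : (maximalIdeal (MvPowerSeries (Fin m) 𝒪) •
      (⊤ : Submodule (MvPowerSeries (Fin m) 𝒪) ↥(RingHom.ker Θ))).map (RingHom.ker Θ).subtype =
      maximalIdeal (MvPowerSeries (Fin m) 𝒪) * RingHom.ker Θ := by
    rw [Submodule.map_smul'', Submodule.map_top, Submodule.range_subtype, Ideal.smul_eq_mul]
  rw [← hmap] at hj
  obtain ⟨y, hy, hyj⟩ := Submodule.mem_map.mp hj
  have e : j = y := Subtype.ext (by simpa using hyj.symm)
  rwa [e]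

include hJn in
omit [IsLocalRing R] in
/-- **The class of the `J`-component in `J/𝔪J` is well defined** (this is where
`J ∩ 𝔪ⁿ ⊆ 𝔪J` is used): if `y = j + z` with `j ∈ J`, `z ∈ 𝔪ⁿ`, then `[jPart y] = [j]`.
[cite: Mazur1989Deforming, §1.6 Prop. 2] -/
theorem mkQ_jPart_eq {y : MvPowerSeries (Fin m) 𝒪}
    (hy : y ∈ RingHom.ker Θ ⊔ maximalIdeal (MvPowerSeries (Fin m) 𝒪) ^ n)
    (j : ↥(RingHom.ker Θ)) (z : MvPowerSeries (Fin m) 𝒪)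
    (hz : z ∈ maximalIdeal (MvPowerSeries (Fin m) 𝒪) ^ n) (h : y = j + z) :
    (Submodule.Quotient.mk (jPart Θ n y hy) : ↥(RingHom.ker Θ) ⧸
        (maximalIdeal (MvPowerSeries (Fin m) 𝒪) •
          (⊤ : Submodule (MvPowerSeries (Fin m) 𝒪) ↥(RingHom.ker Θ)))) =
      Submodule.Quotient.mk j := by
  obtain ⟨z', hz', hy'⟩ := jPart_spec Θ n y hy
  rw [← sub_eq_zero, ← Submodule.Quotient.mk_sub]
  refine mkQ_eq_zero_of_mem_mul Θ (hJn ⟨(jPart Θ n y hy - j).2, ?_⟩)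
  have e : ((jPart Θ n y hy - j : ↥(RingHom.ker Θ)) : MvPowerSeries (Fin m) 𝒪) = z - z' := by
    rw [AddSubgroupClass.coe_sub]
    have := hy'.symm.trans h
    linear_combination this
  rw [e]
  exact Ideal.sub_mem _ hz hz'

/-! ## 4. The coefficient functional `Λ_u` on the mother extension -/

open scoped Classical in
/-- **The coefficient functional** `Λ_u : 𝒪⟦T⟧/(𝔪J + 𝔪ⁿ) → κ` (`κ = 𝒪⟦T⟧/𝔪`): on the kernel of
`q₀` it sends `[j + z]` (`j ∈ J`, `z ∈ 𝔪ⁿ`) to `u [j]`; elsewhere it is `0`.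
[cite: Mazur1989Deforming, §1.6 Prop. 2] -/
def coeffFun (x : MvPowerSeries (Fin m) 𝒪 ⧸ motherIdeal Θ n) :
    MvPowerSeries (Fin m) 𝒪 ⧸ maximalIdeal (MvPowerSeries (Fin m) 𝒪) :=
  if h : ∃ y ∈ RingHom.ker Θ ⊔ maximalIdeal (MvPowerSeries (Fin m) 𝒪) ^ n,
      Ideal.Quotient.mk (motherIdeal Θ n) y = x then
    u (Submodule.Quotient.mk (jPart Θ n (Classical.choose h) (Classical.choose_spec h).1))
  else 0

include hJn in
omit [IsLocalRing R] in
/-- **`Λ_u [j + z] = u [j]`.** [cite: Mazur1989Deforming, §1.6 Prop. 2] -/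
theorem coeffFun_mk (j : ↥(RingHom.ker Θ)) (z : MvPowerSeries (Fin m) 𝒪)
    (hz : z ∈ maximalIdeal (MvPowerSeries (Fin m) 𝒪) ^ n) :
    coeffFun Θ n u (Ideal.Quotient.mk (motherIdeal Θ n) ((j : MvPowerSeries (Fin m) 𝒪) + z)) =
      u (Submodule.Quotient.mk j) := by
  classical
  have hex : ∃ y ∈ RingHom.ker Θ ⊔ maximalIdeal (MvPowerSeries (Fin m) 𝒪) ^ n,
      Ideal.Quotient.mk (motherIdeal Θ n) y =
        Ideal.Quotient.mk (motherIdeal Θ n) ((j : MvPowerSeries (Fin m) 𝒪) + z) :=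
    ⟨_, Submodule.add_mem_sup j.2 hz, rfl⟩
  unfold coeffFun
  rw [dif_pos hex]
  congr 1
  -- the chosen preimage `y` differs from `j + z` by an element of `𝔪J + 𝔪ⁿ`
  set y := Classical.choose hex with hydef
  have hy : y ∈ RingHom.ker Θ ⊔ maximalIdeal (MvPowerSeries (Fin m) 𝒪) ^ n :=
    (Classical.choose_spec hex).1
  have hyx : Ideal.Quotient.mk (motherIdeal Θ n) y =
      Ideal.Quotient.mk (motherIdeal Θ n) ((j : MvPowerSeries (Fin m) 𝒪) + z) :=
    (Classical.choose_spec hex).2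
  rw [Ideal.Quotient.eq] at hyx
  obtain ⟨a, ha, w, hw, haw⟩ := Submodule.mem_sup.mp hyx
  -- `y = (j + a') + (z + w)` with `a ∈ 𝔪J ⊆ J`
  have haJ : a ∈ RingHom.ker Θ := Ideal.mul_le_left ha
  have hdec : y = ((j + ⟨a, haJ⟩ : ↥(RingHom.ker Θ)) : MvPowerSeries (Fin m) 𝒪) + (z + w) := by
    have e1 : y - ((j : MvPowerSeries (Fin m) 𝒪) + z) = a + w := haw.symm
    rw [AddMemClass.coe_add]
    change y = ((j : MvPowerSeries (Fin m) 𝒪) + a) + (z + w)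
    linear_combination e1
  rw [mkQ_jPart_eq Θ n hJn hy (j + ⟨a, haJ⟩) (z + w) (Ideal.add_mem _ hz hw) hdec,
    Submodule.Quotient.mk_add, mkQ_eq_zero_of_mem_mul Θ (j := ⟨a, haJ⟩) ha, add_zero]

omit [IsLocalRing R] in
/-- `Λ_u` vanishes off the kernel of `q₀`. [folklore] -/
theorem coeffFun_of_not_mem (x : MvPowerSeries (Fin m) 𝒪 ⧸ motherIdeal Θ n)
    (hx : ¬ ∃ y ∈ RingHom.ker Θ ⊔ maximalIdeal (MvPowerSeries (Fin m) 𝒪) ^ n,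
      Ideal.Quotient.mk (motherIdeal Θ n) y = x) :
    coeffFun Θ n u x = 0 := by
  classical
  unfold coeffFun
  rw [dif_neg hx]

omit [IsLocalRing R] in
/-- **Additivity in `u`**: `Λ_{u + u'} = Λ_u + Λ_{u'}`. [cite: Mazur1989Deforming, §1.6 Prop. 2] -/
theorem coeffFun_add
    (u' : Module.Dual (MvPowerSeries (Fin m) 𝒪 ⧸ maximalIdeal (MvPowerSeries (Fin m) 𝒪))
      (↥(RingHom.ker Θ) ⧸ (maximalIdeal (MvPowerSeries (Fin m) 𝒪) •
        (⊤ : Submodule (MvPowerSeries (Fin m) 𝒪) ↥(RingHom.ker Θ)))))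
    (x : MvPowerSeries (Fin m) 𝒪 ⧸ motherIdeal Θ n) :
    coeffFun Θ n (u + u') x = coeffFun Θ n u x + coeffFun Θ n u' x := by
  classical
  unfold coeffFun
  split_ifs with h
  · rfl
  · rw [add_zero]

omit [IsLocalRing R] in
/-- **Homogeneity in `u`**: `Λ_{c u} = c Λ_u`. [folklore] -/
theorem coeffFun_smul (c : MvPowerSeries (Fin m) 𝒪 ⧸ maximalIdeal (MvPowerSeries (Fin m) 𝒪))
    (x : MvPowerSeries (Fin m) 𝒪 ⧸ motherIdeal Θ n) :
    coeffFun Θ n (c • u) x = c * coeffFun Θ n u x := by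
  classical
  unfold coeffFun
  split_ifs with h
  · rfl
  · rw [mul_zero]

/-- The residue map `B₀ → κ`. [folklore] -/
def motherResidue (hn0 : n ≠ 0) :
    (MvPowerSeries (Fin m) 𝒪 ⧸ motherIdeal Θ n) →+*
      MvPowerSeries (Fin m) 𝒪 ⧸ maximalIdeal (MvPowerSeries (Fin m) 𝒪) :=
  Ideal.Quotient.factor (motherIdeal_le_maximalIdeal Θ n hn0)

omit [IsLocalRing R] in
/-- `motherResidue` on residue classes. [folklore] -/
@[simp] theorem motherResidue_mk (hn0 : n ≠ 0) (x : MvPowerSeries (Fin m) 𝒪) :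
    motherResidue Θ n hn0 (Ideal.Quotient.mk (motherIdeal Θ n) x) =
      Ideal.Quotient.mk (maximalIdeal (MvPowerSeries (Fin m) 𝒪)) x :=
  rfl

include hJn in
/-- **`Λ_u` is kernel-additive and `res`-semilinear** (for `ker q₀` and the residue map): the
input of `LiftingObstruction.kernelEntrywise`. [cite: Mazur1989Deforming, §1.6 Prop. 2] -/
theorem isKernelSemilinear_coeffFun (hn0 : n ≠ 0) :
    LiftingObstruction.IsKernelSemilinear
      (φ := (q0Raw Θ hΘ n : (MvPowerSeries (Fin m) 𝒪 ⧸ motherIdeal Θ n) →+* R ⧸ maximalIdeal R ^ n))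
      (motherResidue Θ n hn0) (coeffFun Θ n u) := by
  -- every kernel element is `mk (j + z)`
  have hker : ∀ x : MvPowerSeries (Fin m) 𝒪 ⧸ motherIdeal Θ n,
      x ∈ RingHom.ker (q0Raw Θ hΘ n : (MvPowerSeries (Fin m) 𝒪 ⧸ motherIdeal Θ n) →+*
        R ⧸ maximalIdeal R ^ n) →
      ∃ (j : ↥(RingHom.ker Θ)) (z : MvPowerSeries (Fin m) 𝒪),
        z ∈ maximalIdeal (MvPowerSeries (Fin m) 𝒪) ^ n ∧
        x = Ideal.Quotient.mk (motherIdeal Θ n) ((j : MvPowerSeries (Fin m) 𝒪) + z) := by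
    intro x hx
    obtain ⟨y, rfl⟩ := Ideal.Quotient.mk_surjective x
    rw [RingHom.mem_ker] at hx
    change q0Raw Θ hΘ n (Ideal.Quotient.mk _ y) = 0 at hx
    rw [q0Raw_mk_eq_zero_iff] at hx
    obtain ⟨j, hj, z, hz, rfl⟩ := Submodule.mem_sup.mp hx
    exact ⟨⟨j, hj⟩, z, hz, rfl⟩
  refine ⟨?_, ?_, ?_⟩
  · have h := coeffFun_mk Θ n u hJn 0 0 (Ideal.zero_mem _)
    simp only [ZeroMemClass.coe_zero, add_zero, map_zero] at h
    simpa using h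
  · intro x y hx hy
    obtain ⟨j, z, hz, rfl⟩ := hker x hx
    obtain ⟨j', z', hz', rfl⟩ := hker y hy
    have e : Ideal.Quotient.mk (motherIdeal Θ n) ((j : MvPowerSeries (Fin m) 𝒪) + z) +
        Ideal.Quotient.mk (motherIdeal Θ n) ((j' : MvPowerSeries (Fin m) 𝒪) + z') =
        Ideal.Quotient.mk (motherIdeal Θ n) (((j + j' : ↥(RingHom.ker Θ)) :
          MvPowerSeries (Fin m) 𝒪) + (z + z')) := by
      rw [← map_add, AddMemClass.coe_add]
      congr 1
      abel
    rw [e, coeffFun_mk Θ n u hJn _ _ hz, coeffFun_mk Θ n u hJn _ _ hz',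
      coeffFun_mk Θ n u hJn _ _ (Ideal.add_mem _ hz hz'), Submodule.Quotient.mk_add, map_add]
  · intro a x c hx
    obtain ⟨j, z, hz, rfl⟩ := hker x hx
    obtain ⟨a₀, rfl⟩ := Ideal.Quotient.mk_surjective a
    obtain ⟨c₀, rfl⟩ := Ideal.Quotient.mk_surjective c
    have hjm : a₀ * (j : MvPowerSeries (Fin m) 𝒪) * c₀ ∈ RingHom.ker Θ :=
      Ideal.mul_mem_right _ _ (Ideal.mul_mem_left _ _ j.2)
    have e : Ideal.Quotient.mk (motherIdeal Θ n) a₀ *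
        Ideal.Quotient.mk (motherIdeal Θ n) ((j : MvPowerSeries (Fin m) 𝒪) + z) *
        Ideal.Quotient.mk (motherIdeal Θ n) c₀ =
        Ideal.Quotient.mk (motherIdeal Θ n)
          (((⟨a₀ * (j : MvPowerSeries (Fin m) 𝒪) * c₀, hjm⟩ : ↥(RingHom.ker Θ)) :
            MvPowerSeries (Fin m) 𝒪) + a₀ * z * c₀) := by
      rw [← map_mul, ← map_mul]
      congr 1
      change a₀ * ((j : MvPowerSeries (Fin m) 𝒪) + z) * c₀ = a₀ * (j : MvPowerSeries (Fin m) 𝒪) * c₀ + a₀ * z * c₀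
      ring
    rw [e, coeffFun_mk Θ n u hJn _ _ (Ideal.mul_mem_right _ _ (Ideal.mul_mem_left _ _ hz)),
      coeffFun_mk Θ n u hJn _ _ hz, motherResidue_mk, motherResidue_mk]
    -- `[a₀ j c₀] = (a₀ c₀ mod 𝔪) • [j]` and `u` is `κ`-linear
    have hsm : (Submodule.Quotient.mk (⟨a₀ * (j : MvPowerSeries (Fin m) 𝒪) * c₀, hjm⟩ :
        ↥(RingHom.ker Θ)) : ↥(RingHom.ker Θ) ⧸ (maximalIdeal (MvPowerSeries (Fin m) 𝒪) •
          (⊤ : Submodule (MvPowerSeries (Fin m) 𝒪) ↥(RingHom.ker Θ)))) =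
        (Ideal.Quotient.mk (maximalIdeal (MvPowerSeries (Fin m) 𝒪)) (a₀ * c₀)) •
          Submodule.Quotient.mk j := by
      have e1 : (⟨a₀ * (j : MvPowerSeries (Fin m) 𝒪) * c₀, hjm⟩ : ↥(RingHom.ker Θ)) =
          (a₀ * c₀) • j := Subtype.ext (by
        change a₀ * (j : MvPowerSeries (Fin m) 𝒪) * c₀ = (a₀ * c₀) * (j : MvPowerSeries (Fin m) 𝒪)
        ring)
      rw [e1, Submodule.Quotient.mk_smul]
      rfl
    rw [hsm, map_smul, smul_eq_mul, map_mul]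
    ring

/-! ## 5. The coefficient functional on the pushed-out extensions `B_u` -/

open scoped Classical in
/-- **The coefficient functional on `B_u = 𝒪⟦T⟧/(J_u + 𝔪ⁿ)`**: `[j + z] ↦ u [j]` on `ker q_u`,
`0` elsewhere. [cite: Mazur1989Deforming, §1.6 Prop. 2] -/
def coeffFunPush (x : MvPowerSeries (Fin m) 𝒪 ⧸ pushoutTruncIdeal Θ u n) :
    MvPowerSeries (Fin m) 𝒪 ⧸ maximalIdeal (MvPowerSeries (Fin m) 𝒪) :=
  if h : ∃ y ∈ RingHom.ker Θ ⊔ maximalIdeal (MvPowerSeries (Fin m) 𝒪) ^ n,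
      Ideal.Quotient.mk (pushoutTruncIdeal Θ u n) y = x then
    u (Submodule.Quotient.mk (jPart Θ n (Classical.choose h) (Classical.choose_spec h).1))
  else 0

omit [IsLocalRing R] in
/-- `u` kills the classes of elements of `J_u`. [cite: Mazur1989Deforming, §1.6 Prop. 2] -/
theorem apply_mkQ_eq_zero_of_mem_pushoutIdeal {a : ↥(RingHom.ker Θ)}
    (ha : (a : MvPowerSeries (Fin m) 𝒪) ∈
      Literature.RingTheory.CompleteLocalRings.pushoutIdeal (RingHom.ker Θ) u) :
    u (Submodule.Quotient.mk a) = 0 := by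
  have h := (Literature.RingTheory.CompleteLocalRings.mem_pushoutIdeal_iff (RingHom.ker Θ) u a).mp ha
  exact h

include hJn in
omit [IsLocalRing R] in
/-- **`Λ_u [j + z] = u [j]` on `B_u`.** [cite: Mazur1989Deforming, §1.6 Prop. 2] -/
theorem coeffFunPush_mk (j : ↥(RingHom.ker Θ)) (z : MvPowerSeries (Fin m) 𝒪)
    (hz : z ∈ maximalIdeal (MvPowerSeries (Fin m) 𝒪) ^ n) :
    coeffFunPush Θ n u (Ideal.Quotient.mk (pushoutTruncIdeal Θ u n)
        ((j : MvPowerSeries (Fin m) 𝒪) + z)) = u (Submodule.Quotient.mk j) := by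
  classical
  have hex : ∃ y ∈ RingHom.ker Θ ⊔ maximalIdeal (MvPowerSeries (Fin m) 𝒪) ^ n,
      Ideal.Quotient.mk (pushoutTruncIdeal Θ u n) y =
        Ideal.Quotient.mk (pushoutTruncIdeal Θ u n) ((j : MvPowerSeries (Fin m) 𝒪) + z) :=
    ⟨_, Submodule.add_mem_sup j.2 hz, rfl⟩
  unfold coeffFunPush
  rw [dif_pos hex]
  set y := Classical.choose hex with hydef
  have hy : y ∈ RingHom.ker Θ ⊔ maximalIdeal (MvPowerSeries (Fin m) 𝒪) ^ n :=
    (Classical.choose_spec hex).1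
  have hyx : Ideal.Quotient.mk (pushoutTruncIdeal Θ u n) y =
      Ideal.Quotient.mk (pushoutTruncIdeal Θ u n) ((j : MvPowerSeries (Fin m) 𝒪) + z) :=
    (Classical.choose_spec hex).2
  rw [Ideal.Quotient.eq] at hyx
  obtain ⟨a, ha, w, hw, haw⟩ := Submodule.mem_sup.mp hyx
  have haJ : a ∈ RingHom.ker Θ := Literature.RingTheory.CompleteLocalRings.pushoutIdeal_le _ u ha
  have hdec : y = ((j + ⟨a, haJ⟩ : ↥(RingHom.ker Θ)) : MvPowerSeries (Fin m) 𝒪) + (z + w) := by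
    have e1 : y - ((j : MvPowerSeries (Fin m) 𝒪) + z) = a + w := haw.symm
    rw [AddMemClass.coe_add]
    change y = ((j : MvPowerSeries (Fin m) 𝒪) + a) + (z + w)
    linear_combination e1
  rw [mkQ_jPart_eq Θ n hJn hy (j + ⟨a, haJ⟩) (z + w) (Ideal.add_mem _ hz hw) hdec,
    Submodule.Quotient.mk_add, map_add, apply_mkQ_eq_zero_of_mem_pushoutIdeal Θ u (a := ⟨a, haJ⟩) ha,
    add_zero]

include hJn in
omit [IsLocalRing R] in
/-- **Compatibility with the mother extension**: `Λ_u^{B_u} ∘ (B₀ → B_u) = Λ_u^{B₀}`.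
[cite: Mazur1989Deforming, §1.6 Prop. 2] -/
theorem coeffFunPush_toPushout (x : MvPowerSeries (Fin m) 𝒪 ⧸ motherIdeal Θ n) :
    coeffFunPush Θ n u (toPushout Θ n u x) = coeffFun Θ n u x := by
  classical
  obtain ⟨y, rfl⟩ := Ideal.Quotient.mk_surjective x
  by_cases hy : y ∈ RingHom.ker Θ ⊔ maximalIdeal (MvPowerSeries (Fin m) 𝒪) ^ n
  · obtain ⟨j, hj, z, hz, rfl⟩ := Submodule.mem_sup.mp hy
    rw [toPushout_mk]
    rw [show j + z = ((⟨j, hj⟩ : ↥(RingHom.ker Θ)) : MvPowerSeries (Fin m) 𝒪) + z from rfl,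
      coeffFunPush_mk Θ n u hJn _ _ hz, coeffFun_mk Θ n u hJn _ _ hz]
  · -- both sides vanish: no preimage in `J + 𝔪ⁿ` on either side
    have h0 : ¬ ∃ y' ∈ RingHom.ker Θ ⊔ maximalIdeal (MvPowerSeries (Fin m) 𝒪) ^ n,
        Ideal.Quotient.mk (motherIdeal Θ n) y' = Ideal.Quotient.mk (motherIdeal Θ n) y := by
      rintro ⟨y', hy', hyy⟩
      rw [Ideal.Quotient.eq] at hyy
      have : y = y' - (y' - y) := by ring
      exact hy (this ▸ Ideal.sub_mem _ hy' (motherIdeal_le_sup Θ n hyy))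
    have h1 : ¬ ∃ y' ∈ RingHom.ker Θ ⊔ maximalIdeal (MvPowerSeries (Fin m) 𝒪) ^ n,
        Ideal.Quotient.mk (pushoutTruncIdeal Θ u n) y' =
          Ideal.Quotient.mk (pushoutTruncIdeal Θ u n) y := by
      rintro ⟨y', hy', hyy⟩
      rw [Ideal.Quotient.eq] at hyy
      have : y = y' - (y' - y) := by ring
      exact hy (this ▸ Ideal.sub_mem _ hy' (pushoutTruncIdeal_le Θ u n hyy))
    rw [toPushout_mk, coeffFun_of_not_mem Θ n u _ h0]
    unfold coeffFunPush
    rw [dif_neg h1]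

include hJn in
omit [IsLocalRing R] in
/-- **`Λ_u` detects `ker q_u`**: for `y ∈ J + 𝔪ⁿ`, `Λ_u [y] = 0 ↔ [y] = 0` in `B_u`.
[cite: Mazur1989Deforming, §1.6 Prop. 2] -/
theorem coeffFunPush_mk_eq_zero_iff {y : MvPowerSeries (Fin m) 𝒪}
    (hy : y ∈ RingHom.ker Θ ⊔ maximalIdeal (MvPowerSeries (Fin m) 𝒪) ^ n) :
    coeffFunPush Θ n u (Ideal.Quotient.mk (pushoutTruncIdeal Θ u n) y) = 0 ↔
      Ideal.Quotient.mk (pushoutTruncIdeal Θ u n) y = 0 := by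
  obtain ⟨j, hj, z, hz, rfl⟩ := Submodule.mem_sup.mp hy
  rw [show j + z = ((⟨j, hj⟩ : ↥(RingHom.ker Θ)) : MvPowerSeries (Fin m) 𝒪) + z from rfl,
    coeffFunPush_mk Θ n u hJn _ _ hz, Ideal.Quotient.eq_zero_iff_mem]
  constructor
  · intro h
    have hjJ : j ∈ Literature.RingTheory.CompleteLocalRings.pushoutIdeal (RingHom.ker Θ) u :=
      (Literature.RingTheory.CompleteLocalRings.mem_pushoutIdeal_iff (RingHom.ker Θ) u ⟨j, hj⟩).mpr h
    exact Ideal.add_mem _ (Ideal.mem_sup_left hjJ) (Ideal.mem_sup_right hz)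
  · intro h
    -- `j + z ∈ J_u + 𝔪ⁿ`: write `j + z = a + w`, so `j - a ∈ J ∩ (…)`; use well-definedness
    obtain ⟨a, ha, w, hw, haw⟩ := Submodule.mem_sup.mp h
    have haJ : a ∈ RingHom.ker Θ := Literature.RingTheory.CompleteLocalRings.pushoutIdeal_le _ u ha
    have hdec : (j : MvPowerSeries (Fin m) 𝒪) + z =
        ((⟨a, haJ⟩ : ↥(RingHom.ker Θ)) : MvPowerSeries (Fin m) 𝒪) + w := haw.symm
    have e := mkQ_jPart_eq Θ n hJn hy ⟨a, haJ⟩ w hw hdec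
    rw [mkQ_jPart_eq Θ n hJn hy ⟨j, hj⟩ z hz rfl] at e
    rw [e]
    exact apply_mkQ_eq_zero_of_mem_pushoutIdeal Θ u (a := ⟨a, haJ⟩) ha

include hJn in
omit [IsLocalRing R] in
/-- **`Λ_u` maps `ker q_u` ONTO `κ` for `u ≠ 0`.** [cite: Mazur1989Deforming, §1.6 Prop. 2] -/
theorem coeffFunPush_surjective (hu : u ≠ 0)
    (t : MvPowerSeries (Fin m) 𝒪 ⧸ maximalIdeal (MvPowerSeries (Fin m) 𝒪)) :
    ∃ j : ↥(RingHom.ker Θ),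
      coeffFunPush Θ n u (Ideal.Quotient.mk (pushoutTruncIdeal Θ u n) j) = t := by
  classical
  letI : Field (MvPowerSeries (Fin m) 𝒪 ⧸ maximalIdeal (MvPowerSeries (Fin m) 𝒪)) :=
    Ideal.Quotient.field _
  -- a class `c` with `u c ≠ 0`, represented by `j₀`
  obtain ⟨c, hc⟩ : ∃ c, u c ≠ 0 := not_forall.mp fun h => hu (LinearMap.ext h)
  obtain ⟨j₀, rfl⟩ := Submodule.Quotient.mk_surjective _ c
  -- scale: `t = u ((t / u[j₀]) • [j₀])`
  obtain ⟨a₀, ha₀⟩ := Ideal.Quotient.mk_surjective (t / u (Submodule.Quotient.mk j₀))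
  refine ⟨a₀ • j₀, ?_⟩
  have e1 : ((a₀ • j₀ : ↥(RingHom.ker Θ)) : MvPowerSeries (Fin m) 𝒪) =
      ((a₀ • j₀ : ↥(RingHom.ker Θ)) : MvPowerSeries (Fin m) 𝒪) + 0 := (add_zero _).symm
  rw [e1, coeffFunPush_mk Θ n u hJn _ _ (Ideal.zero_mem _), Submodule.Quotient.mk_smul]
  have e2 : (a₀ • Submodule.Quotient.mk j₀ : ↥(RingHom.ker Θ) ⧸
      (maximalIdeal (MvPowerSeries (Fin m) 𝒪) •
        (⊤ : Submodule (MvPowerSeries (Fin m) 𝒪) ↥(RingHom.ker Θ)))) =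
      (Ideal.Quotient.mk (maximalIdeal (MvPowerSeries (Fin m) 𝒪)) a₀) • Submodule.Quotient.mk j₀ :=
    rfl
  rw [e2, map_smul, ha₀, smul_eq_mul, div_mul_cancel₀ _ hc]

end Mother

end NearlyOrdinaryPresentationCA

end Literature.NumberTheory.GaloisRepresentations
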